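import Summits.Ventures.Crystal3D.Theorems.StickyWulffConstantCoaxialWallLawHalfPlanarFrame
import Summits.Ventures.Crystal3D.Theorems.StickyWulffConstantCoaxialWallLawAzimuthSchedulingFwd
import Summits.Ventures.Crystal3D.Theorems.StickyWulffConstantCoaxialWallLawBiPlanarRowDefs
import Summits.Ventures.Crystal3D.Theorems.StickyWulffConstantCoaxialWallLawHexagonRigidity
import Mathlib.Data.List.Sort
import HarnessLib

/-!
# The planar-heights kissing row at offset `½` HOLDS, and the (F-γ) bi-planar rung at offset `½` (kernel certificate)

HONEST FRAMING. Part of the venture `Summits/Ventures/Crystal3D` (cell `crystal3d-full`), helper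
`--supports` the crux `CoaxialWallLaw` (stmt-Ventures-19481, `route-Ventures-StickyWulffConstant`),
REGISTERED line `WallLedgerF`, open stub `stub_coaxialTwoSlabAdhesion`.  RUNG CREDIT ONLY; F-C1 not moved.

* `halfPlanar_card_le_eleven` — **THE ROW AT `τ = ½`**: a finite set `S` of unit vectors, pairwise at
  distance `≥ 1`, each at frame height in `(√(2/3)/2)·ℤ` along a unit axis `m`, containing the in-plane unit
  vector `−d` and not `d`, has at most `11` members.  PROOF: species `0, ±a, ±2a` (`…HalfPlanarKey`); a
  twelve-member sub-configuration containing `−d` is sorted by azimuth in the frame `(−d, m × (−d), m)`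
  (`…HalfPlanarFrame`); the pair lemma gives both azimuth arcs `≥ δ(s,t)`, hence `≥ hpTbl[s][t]·10⁻⁴`; at most
  five members at height `0` (`inPlane_six_antipode`, hexagon rigidity); and the cyclic-scheduling checker
  refutes every such 12-point pattern: `hp_cert : azSearchF hpTbl 62832 [5,12,12,12,12] 0 12 = true`
  (`native_decide`, COMPUTATIONAL GRADE; ≈ 5·10⁴ search nodes, seconds), sound by `azSearchF_sound`
  (`…AzimuthSchedulingFwd`; `decide +kernel` exceeds the default heartbeats).
  Numerics (kit j306954, exact enumeration): uniform robustness margin of the row at `τ = ½` is `4.78°`;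
  the table rounds each separation down by `≤ 1.4°`.
* `biPlanarEndRow_half` — `BiPlanarEndRow (k₀ + ½)` for every `k₀ : ℤ` (`…BiPlanarRowDefs`).
* **`coaxialTwoSlabAdhesion_biPlanar_half`** — the (F-γ) BI-PLANAR RUNG AT OFFSET ½: for every co-axial pair
  whose frame offset is a half-integer number of layer spacings (`(L⁻¹(s₂ − s₁))₂ = (k₀ + ½)√(2/3)`; grain 2's
  basal planes exactly half-way between grain 1's — the class of lit's rigid optimum `T*`, `t_z = d/2`),
  EVERY filling with every ball on a basal plane of grain 1 or of grain 2 (in-plane positions free) satisfies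
  the stub's inequality with constant `√6/4 ≈ 0.61 ≥ ½` (`coaxialTwoSlabAdhesion_biPlanar_of`, `…BiPlanarRow`).

WHAT THIS IS NOT: other offsets (the row is FALSE at `τ ≡ ±⅓`, margins vanish at `τ → 0, ⅓, ⅔, 1`);
general fillings; F-C1 not moved.
-/

noncomputable section

namespace Summit.Ventures.Crystal3D.Theorems

open Finset Real
open Literature.Algebra.EuclideanLattices (inner_fin_three)
open scoped InnerProductSpace


/-! ## Species of a member -/

/-- The species index of a height `h ∈ (√(2/3)/2)·{0, 1, −1, 2, −2}`. -/
def hpSp (h : ℝ) : ℕ :=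
  if h = 0 then 0 else if h = Real.sqrt (2 / 3) / 2 then 1
  else if h = -(Real.sqrt (2 / 3) / 2) then 2 else if h = Real.sqrt (2 / 3) then 3 else 4

/-- Species indices are `< 5`. -/
theorem hpSp_lt (h : ℝ) : hpSp h < 5 := by
  unfold hpSp; split_ifs <;> norm_num

/-- A height `j·(√(2/3)/2)` with `|·| ≤ 1` is one of the five species heights. -/
theorem hpH_hpSp {h : ℝ} {j : ℤ} (hj : h = j * (Real.sqrt (2 / 3) / 2)) (habs : |h| ≤ 1) :
    hpH (hpSp h) = h := by
  have hs := hp_sqrt23_sq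
  have hspos : 0 < Real.sqrt (2 / 3) := Real.sqrt_pos.2 (by norm_num)
  have hj2 : (j : ℝ) ^ 2 ≤ 6 := by
    have h1 : h ^ 2 ≤ 1 := by
      have := abs_le.1 habs; nlinarith [this.1, this.2]
    rw [hj] at h1
    nlinarith [h1, hs]
  have hjZ : j ^ 2 ≤ 6 := by exact_mod_cast hj2
  have hjr : -2 ≤ j ∧ j ≤ 2 := by constructor <;> nlinarith [hjZ, sq_nonneg (j + 2), sq_nonneg (j - 2)]
  obtain ⟨hj1, hj2'⟩ := hjr
  have hA0 : Real.sqrt (2 / 3) / 2 ≠ 0 := by positivity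
  unfold hpSp
  interval_cases j
  · -- j = -2
    have hj' : h = -Real.sqrt (2 / 3) := by rw [hj]; push_cast; ring
    rw [hj', if_neg (by linarith), if_neg (by linarith), if_neg (by linarith), if_neg (by linarith), hpH_4]
  · -- j = -1
    have hj' : h = -(Real.sqrt (2 / 3) / 2) := by rw [hj]; push_cast; ring
    rw [hj', if_neg (by linarith), if_neg (by linarith), if_pos rfl, hpH_2]
  · -- j = 0
    have hj' : h = 0 := by rw [hj]; push_cast; ring
    rw [hj', if_pos rfl, hpH_0]
  · -- j = 1
    have hj' : h = Real.sqrt (2 / 3) / 2 := by rw [hj]; push_cast; ring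
    rw [hj', if_neg (by linarith), if_pos rfl, hpH_1]
  · -- j = 2
    have hj' : h = Real.sqrt (2 / 3) := by rw [hj]; push_cast; ring
    rw [hj', if_neg (by linarith), if_neg (by linarith), if_neg (by linarith), if_pos rfl, hpH_3]

/-- Species `0` is exactly height `0`. -/
theorem hpSp_eq_zero_iff {h : ℝ} (hH : hpH (hpSp h) = h) : hpSp h = 0 ↔ h = 0 := by
  constructor
  · intro h0; rw [← hH, h0, hpH_0]
  · intro h0; unfold hpSp; rw [if_pos h0]

/-! ## Counting helper -/

/-- Auxiliary fact `count_map_range_eq_card` (see the module docstring). -/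
theorem count_map_range_eq_card (s : ℕ → ℕ) (a N : ℕ) :
    ((List.range N).map s).count a = ((Finset.range N).filter fun i => s i = a).card := by
  induction N with
  | zero => simp
  | succ n ih =>
      rw [List.range_succ, List.map_append, List.count_append, ih, Finset.range_add_one,
        Finset.filter_insert, List.map_singleton, List.count_singleton]
      by_cases h : s n = a
      · rw [if_pos h, if_pos (by simp [h]), Finset.card_insert_of_notMem (by simp)]
      · rw [if_neg h, if_neg (by simp [h])]
        rfl

/-! ## The certificate -/

/-- The cyclic-scheduling certificate at offset `½` (computational: `native_decide`). -/
theorem hp_cert : azSearchF hpTbl 62832 [5, 12, 12, 12, 12] 0 12 = true := by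
  native_decide

/-! ## The row at offset ½ -/

/-- **The planar-heights kissing row at offset `½` holds**: a finite set `S` of unit vectors, pairwise at
distance `≥ 1`, each at frame height in `(√(2/3)/2)·ℤ` along the unit axis `m`, containing the in-plane
unit vector `−d` and not `d`, has at most `11` members. -/
theorem halfPlanar_card_le_eleven (m d : EuclideanSpace ℝ (Fin 3)) (S : Finset (EuclideanSpace ℝ (Fin 3)))
    (hm : ‖m‖ = 1) (hd : ‖d‖ = 1) (hdm : ⟪d, m⟫_ℝ = 0)
    (h1 : ∀ v ∈ S, ‖v‖ = 1)
    (hh : ∀ v ∈ S, ∃ j : ℤ, ⟪v, m⟫_ℝ = j * (Real.sqrt (2 / 3) / 2))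
    (hsep : ∀ v ∈ S, ∀ w ∈ S, v ≠ w → 1 ≤ dist v w)
    (hneg : -d ∈ S) (hpos : d ∉ S) : S.card ≤ 11 := by
  classical
  by_contra hlt
  push Not at hlt
  set e : EuclideanSpace ℝ (Fin 3) := -d with hedef
  have he : ‖e‖ = 1 := by rw [hedef, norm_neg, hd]
  have hme : ⟪e, m⟫_ℝ = 0 := by rw [hedef, inner_neg_left, hdm, neg_zero]
  -- species heights of members
  have hspec : ∀ v ∈ S, hpH (hpSp ⟪v, m⟫_ℝ) = ⟪v, m⟫_ℝ := by
    intro v hv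
    obtain ⟨j, hj⟩ := hh v hv
    refine hpH_hpSp hj ?_
    have := abs_real_inner_le_norm v m
    rw [h1 v hv, hm, one_mul] at this
    exact this
  -- at most five members at height 0 (hexagon rigidity)
  set S₀ : Finset (EuclideanSpace ℝ (Fin 3)) := S.filter fun v => ⟪v, m⟫_ℝ = 0 with hS₀
  have hS₀5 : S₀.card ≤ 5 := by
    by_contra h6
    push Not at h6
    have hanti := inPlane_six_antipode (n := m) (a := e) hm S₀
      (fun u hu => h1 u (mem_filter.1 hu).1) (fun u hu => (mem_filter.1 hu).2)
      (by
        intro u hu u' hu' hne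
        have hu1 := h1 u (mem_filter.1 hu).1
        have hu'1 := h1 u' (mem_filter.1 hu').1
        have hdd := hsep u (mem_filter.1 hu).1 u' (mem_filter.1 hu').1 hne
        have hsq : ‖u - u'‖ ^ 2 = ‖u‖ ^ 2 - 2 * ⟪u, u'⟫_ℝ + ‖u'‖ ^ 2 := norm_sub_sq_real u u'
        rw [hu1, hu'1] at hsq
        rw [dist_eq_norm] at hdd
        nlinarith [hsq, hdd])
      h6 (mem_filter.2 ⟨hneg, hme⟩)
    have : d ∈ S := (mem_filter.1 (by rwa [hedef, neg_neg] at hanti)).1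
    exact hpos this
  -- an 11-subset of `S \ {e}`, sorted by azimuth
  have h11 : 11 ≤ (S.erase e).card := by rw [card_erase_of_mem hneg]; omega
  obtain ⟨T, hTsub, hTcard⟩ := Finset.exists_subset_card_eq h11
  have hTS : ∀ w ∈ T, w ∈ S := fun w hw => mem_of_mem_erase (hTsub hw)
  have hTne : ∀ w ∈ T, w ≠ e := fun w hw => ne_of_mem_erase (hTsub hw)
  let r : EuclideanSpace ℝ (Fin 3) → EuclideanSpace ℝ (Fin 3) → Prop := fun v w => hpAz m e v ≤ hpAz m e w
  haveI : Std.Total r := ⟨fun v w => le_total _ _⟩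
  haveI : IsTrans (EuclideanSpace ℝ (Fin 3)) r := ⟨fun a b c hab hbc => le_trans hab hbc⟩
  set L : List (EuclideanSpace ℝ (Fin 3)) := T.toList.insertionSort r with hLdef
  have hLperm : L.Perm T.toList := List.perm_insertionSort r _
  have hLlen : L.length = 11 := by rw [hLperm.length_eq, Finset.length_toList, hTcard]
  have hLnodup : L.Nodup := hLperm.nodup_iff.2 (Finset.nodup_toList T)
  have hLmem : ∀ x, x ∈ L ↔ x ∈ T := fun x => by rw [hLperm.mem_iff, Finset.mem_toList]
  have hLsorted : L.Pairwise r := List.pairwise_insertionSort r _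
  -- the sequence: `e` first, then `L`
  let seq : ℕ → EuclideanSpace ℝ (Fin 3) := fun i => if i = 0 then e else L.getD (i - 1) 0
  have hseq0 : seq 0 = e := by simp [seq]
  have hseqS : ∀ i (hi : 1 ≤ i) (hi12 : i < 12), seq i = L[i - 1]'(by rw [hLlen]; omega) := by
    intro i hi hi12
    have : seq i = L.getD (i - 1) 0 := by simp [seq, show i ≠ 0 by omega]
    rw [this, List.getD_eq_getElem]
  have hmemS : ∀ i, i < 12 → seq i ∈ S := by
    intro i hi
    by_cases h0 : i = 0
    · rw [h0, hseq0]; exact hneg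
    · rw [hseqS i (by omega) hi]
      exact hTS _ ((hLmem _).1 (List.getElem_mem _))
  have hneS : ∀ i, 1 ≤ i → i < 12 → seq i ≠ e := by
    intro i hi hi12
    rw [hseqS i hi hi12]
    exact hTne _ ((hLmem _).1 (List.getElem_mem _))
  have hinj : ∀ i j, i < j → j < 12 → seq i ≠ seq j := by
    intro i j hij hj heq
    by_cases h0 : i = 0
    · rw [h0, hseq0] at heq
      exact hneS j (by omega) hj heq.symm
    · rw [hseqS i (by omega) (by omega), hseqS j (by omega) hj] at heq
      have := (hLnodup.getElem_inj_iff).1 heq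
      omega
  have hle : ∀ i j, i < j → j < 12 → hpAz m e (seq i) ≤ hpAz m e (seq j) := by
    intro i j hij hj
    by_cases h0 : i = 0
    · rw [h0, hseq0, hpAz_self he]; exact hpAz_nonneg _ _ _
    · rw [hseqS i (by omega) (by omega), hseqS j (by omega) hj]
      exact (List.pairwise_iff_getElem.1 hLsorted) (i - 1) (j - 1) _ _ (by omega)
  -- species and positions
  let sp : ℕ → ℕ := fun i => hpSp ⟪seq i, m⟫_ℝ
  let θ : ℕ → ℝ := fun i => 10000 * hpAz m e (seq i)
  have h2π : 10000 * (2 * π) ≤ (62832 : ℝ) := by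
    have := Real.pi_lt_d4; nlinarith
  refine azSearchF_sound hp_cert (by norm_num) sp θ (fun i _ => hpSp_lt _) ?_ ?_ ?_ ?_
  · -- root species
    show hpSp ⟪seq 0, m⟫_ℝ = 0
    rw [hseq0, hme]; unfold hpSp; rw [if_pos rfl]
  · -- positions are measured from `e`
    intro i hi
    show 10000 * hpAz m e (seq 0) ≤ 10000 * hpAz m e (seq i)
    rw [hseq0, hpAz_self he]
    have := hpAz_nonneg m e (seq i)
    nlinarith
  · -- separations
    intro i j hij hj
    have hi12 : i < 12 := by omega
    have hv := hmemS i hi12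
    have hw := hmemS j hj
    have hpair := hp_pair hm he hme (h1 _ hv) (h1 _ hw) (hpSp_lt _) (hpSp_lt _)
      (hspec _ hv).symm (hspec _ hw).symm (hsep _ hv _ hw (hinj i j hij hj)) (hle i j hij hj)
    have htbl := hp_tbl (sp i) (sp j) (hpSp_lt _) (hpSp_lt _)
    obtain ⟨hp1, hp2⟩ := hpair
    show ((azGet hpTbl (sp i) (sp j) : ℤ) : ℝ) ≤ 10000 * hpAz m e (seq j) - 10000 * hpAz m e (seq i) ∧
      ((azGet hpTbl (sp i) (sp j) : ℤ) : ℝ) ≤ 10000 * hpAz m e (seq i) + 62832 - 10000 * hpAz m e (seq j)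
    constructor <;> nlinarith [hp1, hp2, htbl, h2π]
  · -- caps
    intro a
    by_cases ha0 : a = 0
    · subst ha0
      show ((List.range 12).map sp).count 0 ≤ 5
      rw [count_map_range_eq_card]
      refine le_trans ?_ hS₀5
      refine Finset.card_le_card_of_injOn seq ?_ ?_
      · intro i hi
        obtain ⟨hi12, hsi⟩ := Finset.mem_filter.1 (Finset.mem_coe.1 hi)
        rw [Finset.mem_range] at hi12
        have hv := hmemS i hi12
        have h0 : ⟪seq i, m⟫_ℝ = 0 := (hpSp_eq_zero_iff (hspec _ hv)).1 hsi
        exact Finset.mem_coe.2 (mem_filter.2 ⟨hv, h0⟩)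
      · intro i hi j hj hij
        have hi12 : i < 12 := Finset.mem_range.1 (Finset.mem_filter.1 (Finset.mem_coe.1 hi)).1
        have hj12 : j < 12 := Finset.mem_range.1 (Finset.mem_filter.1 (Finset.mem_coe.1 hj)).1
        by_contra hne
        rcases Nat.lt_or_gt_of_ne hne with hlt' | hlt'
        · exact hinj i j hlt' hj12 hij
        · exact hinj j i hlt' hi12 hij.symm
    · by_cases ha5 : a < 5
      · have hcap : [5, 12, 12, 12, 12].getD a 0 = 12 := by
          interval_cases a <;> simp at ha0 ⊢
        rw [hcap]
        exact le_trans List.count_le_length (by simp)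
      · have hcap : [5, 12, 12, 12, 12].getD a 0 = 0 := by
          rw [List.getD_eq_default]; simp; omega
        rw [hcap, Nat.le_zero, List.count_eq_zero]
        intro hmem
        obtain ⟨i, -, hi⟩ := List.mem_map.1 hmem
        have := hpSp_lt ⟪seq i, m⟫_ℝ
        change sp i < 5 at this
        omega

end Summit.Ventures.Crystal3D.Theorems


namespace Summit.Ventures.Crystal3D.Theorems

open Finset Real
open Literature.MathematicalPhysics.StatisticalMechanics (fccStacking barlowStacking IsHaggSeq
  contactDeficiency)
open scoped InnerProductSpace

/-! ## The (F-γ) bi-planar rung at offset ½ -/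

open scoped Classical in
/-- **The (F-γ) BI-PLANAR rung of `stub_coaxialTwoSlabAdhesion` at offset `½`** (explicit frame, constant
`√6/4 ≥ ½`): for a co-axial pair whose frame offset is a half-integer number of layer spacings — grain 2's
basal planes exactly half-way between grain 1's (the class of lit's rigid optimum `T*`) — every filling with
every ball on a basal plane of grain 1 or of grain 2 (in-plane positions FREE) satisfies
`cross ≤ D(Y) + (φ₁ + φ₂ − (√6/4)·sin θ)πρ² + C(1+h)ρ`. -/
theorem coaxialTwoSlabAdhesion_biPlanar_half
    (A₁ : EuclideanSpace ℝ (Fin 3) ≃ₗᵢ[ℝ] EuclideanSpace ℝ (Fin 3)) (t₁ : EuclideanSpace ℝ (Fin 3))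
    (A₂ : EuclideanSpace ℝ (Fin 3) ≃ₗᵢ[ℝ] EuclideanSpace ℝ (Fin 3)) (t₂ : EuclideanSpace ℝ (Fin 3))
    (L : EuclideanSpace ℝ (Fin 3) ≃ₗᵢ[ℝ] EuclideanSpace ℝ (Fin 3)) (s₁ s₂ : EuclideanSpace ℝ (Fin 3))
    {σ σ' : ℤ → ℤ} (hσ : IsHaggSeq σ) (hσ' : IsHaggSeq σ')
    (hsub₁ : (fun p => A₁ p + t₁) '' fccStacking 1 (Real.sqrt (2 / 3)) ⊆
      (fun p => L p + s₁) '' barlowStacking 1 (Real.sqrt (2 / 3)) σ)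
    (hsub₂ : (fun p => A₂ p + t₂) '' fccStacking 1 (Real.sqrt (2 / 3)) ⊆
      (fun p => L p + s₂) '' barlowStacking 1 (Real.sqrt (2 / 3)) σ')
    {k₀ : ℤ} (hhalf : (L.symm (s₂ - s₁)) 2 = (k₀ + 1 / 2) * Real.sqrt (2 / 3)) :
    ∃ C : ℝ, ∀ h : ℝ, 0 ≤ h → ∀ ρ : ℝ, 10 ≤ ρ →
      ∀ X P₁ P₂ : Finset (EuclideanSpace ℝ (Fin 3)),
      (∀ p ∈ X, ∀ q ∈ X, p ≠ q → 1 ≤ dist p q) → P₁ ⊆ X → P₂ ⊆ X \ P₁ →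
      (∀ p ∈ X, -(2 * 10) ≤ p 2 ∧ p 2 ≤ h + 2 * 10 ∧ p 0 ^ 2 + p 1 ^ 2 ≤ ρ ^ 2) →
      (∀ p, p ∈ P₁ ↔ (p ∈ (fun q => A₁ q + t₁) '' fccStacking 1 (Real.sqrt (2 / 3)) ∧
        -(2 * 10) ≤ p 2 ∧ p 2 ≤ -10 ∧ p 0 ^ 2 + p 1 ^ 2 ≤ ρ ^ 2)) →
      (∀ p, p ∈ P₂ ↔ (p ∈ (fun q => A₂ q + t₂) '' fccStacking 1 (Real.sqrt (2 / 3)) ∧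
        h + 10 ≤ p 2 ∧ p 2 ≤ h + 2 * 10 ∧ p 0 ^ 2 + p 1 ^ 2 ≤ ρ ^ 2)) →
      (∀ p ∈ X, (∃ k : ℤ, (L.symm (p - s₁)) 2 = k * Real.sqrt (2 / 3)) ∨
        (∃ k : ℤ, (L.symm (p - s₂)) 2 = k * Real.sqrt (2 / 3))) →
      ((((P₁ ×ˢ (X \ P₁)).filter fun pq => dist pq.1 pq.2 = 1).card : ℕ) : ℝ) +
        ((((P₂ ×ˢ ((X \ P₁) \ P₂)).filter fun pq => dist pq.1 pq.2 = 1).card : ℕ) : ℝ) ≤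
        contactDeficiency ((X \ P₁) \ P₂) +
          (Real.sqrt 2 / 4 * ∑ᶠ w ∈ {w ∈ fccStacking 1 (Real.sqrt (2 / 3)) | ‖w‖ = 1},
              |⟪w, A₁.symm (EuclideanSpace.single (2 : Fin 3) (1 : ℝ))⟫_ℝ| +
            Real.sqrt 2 / 4 * ∑ᶠ w ∈ {w ∈ fccStacking 1 (Real.sqrt (2 / 3)) | ‖w‖ = 1},
              |⟪w, A₂.symm (EuclideanSpace.single (2 : Fin 3) (1 : ℝ))⟫_ℝ| -
            (Real.sqrt 6 / 4 : ℝ) * Real.sqrt (1 - ⟪L (EuclideanSpace.single (2 : Fin 3) (1 : ℝ)),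
              (EuclideanSpace.single (2 : Fin 3) (1 : ℝ))⟫_ℝ ^ 2)) * Real.pi * ρ ^ 2 +
          C * (1 + h) * ρ := by
  have hs0 : 0 < Real.sqrt (2 / 3) := Real.sqrt_pos.2 (by norm_num)
  -- a half-integer offset is not an integer one
  have hinc : ¬ ∃ k : ℤ, (L.symm (s₂ - s₁)) 2 = k * Real.sqrt (2 / 3) := by
    rintro ⟨k, hk⟩
    rw [hhalf] at hk
    have h1 : ((k₀ : ℝ) + 1 / 2) = k := by
      have := mul_right_cancel₀ hs0.ne' hk
      exact this
    have h2 : (2 * k₀ + 1 : ℤ) = 2 * k := by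
      have : (2 : ℝ) * k₀ + 1 = 2 * k := by linarith
      exact_mod_cast this
    omega
  refine coaxialTwoSlabAdhesion_biPlanar_of A₁ t₁ A₂ t₂ L s₁ s₂ hσ hσ' hsub₁ hsub₂ hinc hhalf ?_
  -- the row at offset `k₀ + ½` from the half-planar theorem
  intro m d S hm hd hdm h1 hh hsep hneg hpos
  refine halfPlanar_card_le_eleven m d S hm hd hdm h1 ?_ hsep hneg hpos
  intro v hv
  obtain ⟨k, hk | hk⟩ := hh v hv
  · exact ⟨2 * k, by rw [hk]; push_cast; ring⟩
  · exact ⟨2 * k + 2 * k₀ + 1, by rw [hk]; push_cast; ring⟩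


/-- **`BiPlanarEndRow` holds at every half-integer offset** (`…BiPlanarRowDefs`). -/
theorem biPlanarEndRow_half (k₀ : ℤ) : BiPlanarEndRow (k₀ + 1 / 2) := by
  intro m d S hm hd hdm h1 hh hsep hneg hpos
  refine halfPlanar_card_le_eleven m d S hm hd hdm h1 ?_ hsep hneg hpos
  intro v hv
  obtain ⟨k, hk | hk⟩ := hh v hv
  · exact ⟨2 * k, by rw [hk]; push_cast; ring⟩
  · exact ⟨2 * k + 2 * k₀ + 1, by rw [hk]; push_cast; ring⟩

end Summit.Ventures.Crystal3D.Theorems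

end
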